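import Literature.Barriers.PneNP.RelativizedCircuitSizeThm31
import Literature.Barriers.PneNP.RelativizedCircuitSizeProofs
import HarnessLib

/-!
# Relativized circuit size (Wilson 1985): discharge of the barrier fact

`RelativizedCircuitSize_holds : RelativizedCircuitSize` — the barrier fact of
`Literature/Barriers/PneNP/RelativizedCircuitSize.lean` (unchanged) is the conjunction of
Wilson's Theorem 3.1 and Theorem 4, both now proved in the tree by stage constructions over the
transcript model of oracle computation:

* `Wilson1985_thm_3_1_holds` (`RelativizedCircuitSizeThm31.lean`): an oracle `B` with
  `Δ₂^{P,B} ⊆ SIZE^B(2n + o(n))` (Lemma 2 forcing construction, one-query circuits);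
* `Wilson1985_thm_4_holds` (`RelativizedCircuitSizeProofs.lean`): an oracle `C` with
  `NP^C ≠ coNP^C` and `∀ k, P^C ⊄ SIZE^C(n^k + k)` (diagonalization, with the counting lemma of
  `RelativizedCircuitSizeCounting.lean`).

With it the readings proved in the barrier entry from the fact
(`RelativizedCircuitSize.summary`, `Wilson1985_thm_3_1.not_relativizes_superlinear_deltaTwo`,
`Wilson1985_thm_4.not_relativizes_fixedPoly_upper`, …) hold unconditionally; the summary is
restated below as `relativizedCircuitSize_summary`.

## References

* [Wilson1985] C. B. Wilson, *Relativized circuit complexity*, J. Comput. Syst. Sci. 31 (1985)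
  169–181, Lemma 2 and Thm. 3.1 (pp. 173–175), Thm. 4 (pp. 176–177) — held, read with
  `lit read`.
-/

namespace Literature.Barriers.PneNP

open Literature.Computability.Complexity

/-- **The barrier fact `RelativizedCircuitSize` holds**: Wilson's Theorems 3.1 and 4.
[cite: Wilson1985, Thms. 3.1 (p. 175) and 4 (p. 176)] -/
theorem RelativizedCircuitSize_holds : RelativizedCircuitSize :=
  ⟨Wilson1985_thm_3_1_holds, Wilson1985_thm_4_holds⟩

/-- The summary no-go readings of the barrier entry, unconditionally: (i) no oracle-indexed
statement whose instances yield a `Δ₂^{P,A}`-language without linear-size `A`-oracle circuits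
relativizes; (ii) none whose instances put `P^A` inside some `SIZE^A(n^k + k)` relativizes.
[cite: Wilson1985, §1.2 (a)–(b) (p. 170), Thms. 3.1 and 4] -/
theorem relativizedCircuitSize_summary :
    (∀ Φ : Oracle → Prop,
      (∀ A : Language Bool, Φ (Oracle.ofLanguage A) →
        ∃ L ∈ DeltaTwoRel A, ∀ c : ℕ, L ∉ SIZERel A (fun n => c * n + c)) →
      ¬ Relativizes Φ) ∧
    ∀ Φ : Oracle → Prop,
      (∀ A : Language Bool, Φ (Oracle.ofLanguage A) →
        ∃ k : ℕ, PRel (Oracle.ofLanguage A) ⊆ SIZERel A (fun n => n ^ k + k)) →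
      ¬ Relativizes Φ :=
  RelativizedCircuitSize_holds.summary

end Literature.Barriers.PneNP
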